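import Literature.Combinatorics.Optimization.ShellLawHalfPinning
import HarnessLib

/-!
# Pinning two half-matched vertices; the crossing containment form as a block statistic minus the half count

Continuation of `ShellLawHalfPinning.lean` (cell pnp-psdrank, prover g22, MEMO-25 §2(c)). Fix a perfect matching (`π` its
fixed-point-free partner involution), a `π`-stable ground set `S`, a block `H`.

* §1 **`sum_shellIn_half_half_eq`** — two half-matched vertices `v, w` on DIFFERENT edges pinned:
  `Σ_{U ∈ Shell_S(t+2,c+2), v,w ∈ half U} g(U) = Σ_{W ∈ Shell_{S∖e_v∖e_w}(t,c)} g(W + w + v)` (lit g32's one-vertex pin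
  `ShellLawWeightedLevelStep.sum_shellIn_half_eq`, twice); the ratio **`card_shellIn_del2_half_ratio`**
  `|S|(|S|−2)·|Shell_{S∖e_v∖e_w}(t,c)| = (c+2)(c+1)·|Shell_S(t+2,c+2)|` — the probability that two given vertices on different edges are
  both half-matched is `(c+2)(c+1)/(|S|(|S|−2))`, QUADRATIC IN THE LEVEL AND VANISHING AT THE TWO LOWEST VIRTUAL LEVELS.
* §2 the block statistic weighted by the number `Y(Y−1)` of ORDERED PAIRS OF CROSSING `H`-VERTICES (`Y = |half U ∩ H|`):
  **`sum_shellIn_halfPairs_blockStat_eq`** `Σ_{U ∈ Shell_S(t+2,c+2)} Y(Y−1)·ψ(|U∩H|) = Σ_{v ∈ S∩H} Σ_{w ∈ (S∩H)∖e_v} Σ_{W ∈ Shell_{S∖e_v∖e_w}(t,c)} ψ(|W∩H|+2)`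
  and the average form **`shellInAvg_halfPairs_blockStat_eq`** with the factor `(c+2)(c+1)/(|S|(|S|−2))`.
* §3 **`sum_crossingWeight_containment_eq`** — the bridge to the cell's (CG_1′) containment form `Σ_p u_p x_p x_{πp}`: for the
  crossing-plane weight `u_p = λ·([p∈H][πp∈H] − [p∉H][πp∉H]) + μ`,
  `Σ_p u_p x_p x_{πp} = λ·(|AA(full U)| − |DD(full U)|) + μ·|full U|`, hence on `Shell_S(t,c)` (with `crossing_containment_eq`)
  `= 2λ·(|U∩H| − |half U ∩ H|) + (μ − λ)·(t − c)` (**`crossingWeight_containment_eq`**): a block statistic, minus `2λ` times the half count,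
  plus a level-linear constant.

All PROVED, 0 sorry, no named facts; bookkeeping on Rothvoß's slack-matrix combinatorics.

## References
* [Rothvoss2017] T. Rothvoß, *The matching polytope has exponential extension complexity*, J. ACM 64 (2017), §2 (PDF pp. 5–6).
* [GodsilMeagher2015] C. Godsil, K. Meagher, *Erdős–Ko–Rado Theorems: Algebraic Approaches*, CUP 2015, §15.2.
-/

noncomputable section

open Finset

namespace Literature.Combinatorics.Optimization

namespace ShellStep

variable {n : ℕ} {π : Fin n → Fin n}

section HalfPinTwo

variable (hπ : ∀ v, π (π v) = v) (hπ' : ∀ v, π v ≠ v)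
include hπ hπ'

/-! ### §1 Two half-matched vertices pinned -/

/-- **Pinning two half-matched vertices on different edges is deleting both edges** (sum form): for `v, w ∈ S`,
`w ∉ e_v`: `Σ_{U ∈ Shell_S(t+2,c+2), v,πv-half, w,πw-half} g(U) = Σ_{W ∈ Shell_{S∖e_v∖e_w}(t,c)} g(W + w + v)`.
[cite: Rothvoss2017, §2 (PDF p. 6)] -/
theorem sum_shellIn_half_half_eq {S : Finset (Fin n)} {v w : Fin n} (hv : v ∈ S) (hw : w ∈ S) (hwv : w ≠ v)
    (hwπ : w ≠ π v) (t c : ℕ) (g : Finset (Fin n) → ℝ) :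
    ∑ U ∈ (shellIn π S (t + 2) (c + 2)).filter (fun U => (v ∈ U ∧ π v ∉ U) ∧ (w ∈ U ∧ π w ∉ U)), g U =
      ∑ W ∈ shellIn π (del2 π S v w) t c, g (insert v (insert w W)) := by
  have hπwv : π w ≠ v := fun h => hwπ (by rw [← h, hπ])
  have hw' : w ∈ S \ {v, π v} := by
    rw [mem_sdiff, mem_insert, mem_singleton, not_or]; exact ⟨hw, hwv, hwπ⟩
  -- first pin `v`, threading the predicate on `w`
  rw [← filter_filter, sum_filter,
    sum_shellIn_half_eq hπ hπ' hv (t + 1) (c + 1) (fun U => if (w ∈ U ∧ π w ∉ U) then g U else 0)]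
  -- `w` is half-matched in `W + v` iff it is in `W`
  have hiff : ∀ W ∈ shellIn π (S \ {v, π v}) (t + 1) (c + 1),
      ((w ∈ insert v W ∧ π w ∉ insert v W) ↔ (w ∈ W ∧ π w ∉ W)) := by
    intro W _
    simp only [mem_insert]
    constructor
    · rintro ⟨hw1, hw2⟩
      exact ⟨hw1.resolve_left hwv, fun h => hw2 (Or.inr h)⟩
    · rintro ⟨hw1, hw2⟩
      exact ⟨Or.inr hw1, fun h => h.elim (fun e => hπwv e) hw2⟩
  rw [sum_congr rfl fun W hW => by rw [if_congr (hiff W hW) rfl rfl], ← sum_filter,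
    sum_shellIn_half_eq hπ hπ' hw' t c (fun W => g (insert v W)), ← del2_eq_sdiff_sdiff]

/-- **Two-half-vertex ratio**: `|S|(|S|−2)·|Shell_{S∖e_v∖e_w}(t,c)| = (c+2)(c+1)·|Shell_S(t+2,c+2)|` for `v, w` on different edges —
the probability that two given vertices on different edges are both half-matched under the uniform cut of `Shell_S(t+2,c+2)` is
`(c+2)(c+1)/(|S|(|S|−2))`, a quadratic polynomial in the level vanishing at the levels `−1, −2 ↦ 0, 1` below.
[cite: Rothvoss2017, §2 (PDF p. 6)] -/
theorem card_shellIn_del2_half_ratio {S : Finset (Fin n)} (hS : ∀ u ∈ S, π u ∈ S) {v w : Fin n}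
    (hv : v ∈ S) (hw : w ∈ S) (hwv : w ≠ v) (hwπ : w ≠ π v) (t c : ℕ) :
    (S.card : ℝ) * ((S.card : ℝ) - 2) * (shellIn π (del2 π S v w) t c).card =
      ((c : ℝ) + 2) * ((c : ℝ) + 1) * (shellIn π S (t + 2) (c + 2)).card := by
  have hw' : w ∈ S \ {v, π v} := by
    rw [mem_sdiff, mem_insert, mem_singleton, not_or]; exact ⟨hw, hwv, hwπ⟩
  have h1 := card_shellIn_sdiff_pair_half_ratio hπ hπ' hS hv (t + 1) (c + 1)
  have h2 := card_shellIn_sdiff_pair_half_ratio hπ hπ' (sdiff_pair_stable hπ hS v) hw' t c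
  rw [← del2_eq_sdiff_sdiff] at h2
  have hc : ((S \ {v, π v}).card : ℝ) = (S.card : ℝ) - 2 := by
    have := card_sdiff_pair hπ' hS hv
    have : ((S \ {v, π v}).card : ℝ) + 2 = S.card := by exact_mod_cast this
    linarith
  rw [hc] at h2
  push_cast at h1 h2
  calc (S.card : ℝ) * ((S.card : ℝ) - 2) * (shellIn π (del2 π S v w) t c).card
      = (S.card : ℝ) * (((S.card : ℝ) - 2) * (shellIn π (del2 π S v w) t c).card) := by ring
    _ = (S.card : ℝ) * (((c : ℝ) + 1) * (shellIn π (S \ {v, π v}) (t + 1) (c + 1)).card) := by rw [h2]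
    _ = ((c : ℝ) + 1) * ((S.card : ℝ) * (shellIn π (S \ {v, π v}) (t + 1) (c + 1)).card) := by ring
    _ = ((c : ℝ) + 1) * (((c : ℝ) + 1 + 1) * (shellIn π S (t + 1 + 1) (c + 1 + 1)).card) := by rw [h1]
    _ = _ := by rw [show t + 1 + 1 = t + 2 by ring, show c + 1 + 1 = c + 2 by ring]; ring

/-- The doubly deleted shell is nonempty as soon as `Shell_S(t+2,c+2)` is. [cite: Rothvoss2017, §2 (PDF p. 6)] -/
theorem shellIn_del2_nonempty_of_half {S : Finset (Fin n)} (hS : ∀ u ∈ S, π u ∈ S) {v w : Fin n}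
    (hv : v ∈ S) (hw : w ∈ S) (hwv : w ≠ v) (hwπ : w ≠ π v) {t c : ℕ} (hne : (shellIn π S (t + 2) (c + 2)).Nonempty) :
    (shellIn π (del2 π S v w) t c).Nonempty := by
  have hw' : w ∈ S \ {v, π v} := by
    rw [mem_sdiff, mem_insert, mem_singleton, not_or]; exact ⟨hw, hwv, hwπ⟩
  have h1 := shellIn_sdiff_pair_nonempty_of_half hπ hπ' hS hv (t := t + 1) (c := c + 1) hne
  have h2 := shellIn_sdiff_pair_nonempty_of_half hπ hπ' (sdiff_pair_stable hπ hS v) hw' h1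
  rwa [← del2_eq_sdiff_sdiff] at h2

/-! ### §2 The block statistic weighted by the number of ordered pairs of crossing `H`-vertices -/

omit hπ hπ' in
/-- The partner of a half-matched vertex is not half-matched. [cite: Rothvoss2017, §2 (PDF p. 5)] -/
theorem partner_notMem_half {U : Finset (Fin n)} {v : Fin n} (hv : v ∈ half π U) : π v ∉ half π U := by
  rw [mem_half] at hv ⊢
  exact fun h => hv.2 h.1

omit hπ hπ' in
/-- **`Y(Y−1)` as a double sum over the pinned pair** (`Y = |half U ∩ H|`, `U ⊆ S`):
`Y(Y−1) = Σ_{v ∈ S∩H} Σ_{w ∈ (S∩H)∖e_v} [v half][w half]` (ordered pairs of distinct crossing `H`-vertices; two half-matched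
vertices are never partners). [cite: Rothvoss2017, §2 (PDF p. 5)] -/
theorem halfCount_mul_pred_eq_sum {S H U : Finset (Fin n)} (hUS : U ⊆ S) :
    ((half π U ∩ H).card : ℝ) * (((half π U ∩ H).card : ℝ) - 1) =
      ∑ v ∈ S ∩ H, ∑ w ∈ (S ∩ H) \ {v, π v},
        (if (v ∈ U ∧ π v ∉ U) then (1 : ℝ) else 0) * (if (w ∈ U ∧ π w ∉ U) then (1 : ℝ) else 0) := by
  have hfil : half π U ∩ H = (S ∩ H).filter (fun v => v ∈ U ∧ π v ∉ U) := half_inter_eq_filter hUS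
  have hY : ((half π U ∩ H).card : ℝ) = ∑ v ∈ S ∩ H, (if (v ∈ U ∧ π v ∉ U) then (1 : ℝ) else 0) := by
    rw [hfil, card_filter]; push_cast
    exact sum_congr rfl fun v _ => by split_ifs <;> simp
  -- the inner sum is `Y − 1` when `v` is a crossing `H`-vertex
  have hinner : ∀ v ∈ S ∩ H, (v ∈ U ∧ π v ∉ U) →
      ∑ w ∈ (S ∩ H) \ {v, π v}, (if (w ∈ U ∧ π w ∉ U) then (1 : ℝ) else 0) = ((half π U ∩ H).card : ℝ) - 1 := by
    intro v hv hvhalf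
    have hvY : v ∈ half π U ∩ H := mem_inter.2 ⟨mem_half.2 hvhalf, (mem_inter.1 hv).2⟩
    have hπvY : π v ∉ half π U ∩ H := fun h => partner_notMem_half (mem_half.2 hvhalf) (mem_inter.1 h).1
    have hset : ((S ∩ H) \ {v, π v}).filter (fun w => w ∈ U ∧ π w ∉ U) = (half π U ∩ H).erase v := by
      ext w
      simp only [mem_filter, mem_sdiff, mem_insert, mem_singleton, not_or, mem_erase, hfil]
      constructor
      · rintro ⟨⟨hw, hwv, _⟩, hwh⟩; exact ⟨hwv, hw, hwh⟩
      · rintro ⟨hwv, hw, hwh⟩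
        refine ⟨⟨hw, hwv, fun e => hπvY ?_⟩, hwh⟩
        rw [hfil, mem_filter]; rw [← e]; exact ⟨hw, hwh⟩
    have hcnt : (∑ w ∈ (S ∩ H) \ {v, π v}, (if (w ∈ U ∧ π w ∉ U) then (1 : ℝ) else 0)) =
        ((((S ∩ H) \ {v, π v}).filter (fun w => w ∈ U ∧ π w ∉ U)).card : ℝ) := by
      rw [card_filter]; push_cast
      exact sum_congr rfl fun w _ => by split_ifs <;> simp
    rw [hcnt, hset, card_erase_of_mem hvY, Nat.cast_sub (card_pos.2 ⟨v, hvY⟩)]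
    simp
  symm
  calc ∑ v ∈ S ∩ H, ∑ w ∈ (S ∩ H) \ {v, π v},
        (if (v ∈ U ∧ π v ∉ U) then (1 : ℝ) else 0) * (if (w ∈ U ∧ π w ∉ U) then (1 : ℝ) else 0)
      = ∑ v ∈ S ∩ H, (if (v ∈ U ∧ π v ∉ U) then (1 : ℝ) else 0) *
          ∑ w ∈ (S ∩ H) \ {v, π v}, (if (w ∈ U ∧ π w ∉ U) then (1 : ℝ) else 0) := by
        refine sum_congr rfl fun v _ => ?_; rw [mul_sum]
    _ = ∑ v ∈ S ∩ H, (if (v ∈ U ∧ π v ∉ U) then (1 : ℝ) else 0) * (((half π U ∩ H).card : ℝ) - 1) := by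
        refine sum_congr rfl fun v hv => ?_
        by_cases h : v ∈ U ∧ π v ∉ U
        · rw [hinner v hv h]
        · rw [if_neg h, zero_mul, zero_mul]
    _ = ((half π U ∩ H).card : ℝ) * (((half π U ∩ H).card : ℝ) - 1) := by rw [← sum_mul, ← hY]

/-- **Pair-count-weighted sums split over the pinned pair**:
`Σ_{U ∈ Shell_S(t+2,c+2)} Y(Y−1)·g(U) = Σ_{v ∈ S∩H} Σ_{w ∈ (S∩H)∖e_v} Σ_{W ∈ Shell_{S∖e_v∖e_w}(t,c)} g(W + w + v)`.
[cite: Rothvoss2017, §2 (PDF p. 6)] -/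
theorem sum_shellIn_halfPairs_mul_eq (S H : Finset (Fin n)) (t c : ℕ) (g : Finset (Fin n) → ℝ) :
    ∑ U ∈ shellIn π S (t + 2) (c + 2),
        ((half π U ∩ H).card : ℝ) * (((half π U ∩ H).card : ℝ) - 1) * g U =
      ∑ v ∈ S ∩ H, ∑ w ∈ (S ∩ H) \ {v, π v}, ∑ W ∈ shellIn π (del2 π S v w) t c, g (insert v (insert w W)) := by
  calc ∑ U ∈ shellIn π S (t + 2) (c + 2), ((half π U ∩ H).card : ℝ) * (((half π U ∩ H).card : ℝ) - 1) * g U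
      = ∑ U ∈ shellIn π S (t + 2) (c + 2), ∑ v ∈ S ∩ H, ∑ w ∈ (S ∩ H) \ {v, π v},
          (if (v ∈ U ∧ π v ∉ U) then (1 : ℝ) else 0) * (if (w ∈ U ∧ π w ∉ U) then (1 : ℝ) else 0) * g U := by
        refine sum_congr rfl fun U hU => ?_
        rw [halfCount_mul_pred_eq_sum (mem_shellIn.1 hU).1, sum_mul]
        exact sum_congr rfl fun v _ => by rw [sum_mul]
    _ = ∑ v ∈ S ∩ H, ∑ U ∈ shellIn π S (t + 2) (c + 2), ∑ w ∈ (S ∩ H) \ {v, π v},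
          (if (v ∈ U ∧ π v ∉ U) then (1 : ℝ) else 0) * (if (w ∈ U ∧ π w ∉ U) then (1 : ℝ) else 0) * g U := sum_comm
    _ = ∑ v ∈ S ∩ H, ∑ w ∈ (S ∩ H) \ {v, π v}, ∑ U ∈ shellIn π S (t + 2) (c + 2),
          (if (v ∈ U ∧ π v ∉ U) then (1 : ℝ) else 0) * (if (w ∈ U ∧ π w ∉ U) then (1 : ℝ) else 0) * g U :=
        sum_congr rfl fun v _ => sum_comm
    _ = _ := by
        refine sum_congr rfl fun v hv => sum_congr rfl fun w hw => ?_
        have hvS : v ∈ S := (mem_inter.1 (mem_inter.1 hv |>.1 |> fun h => mem_inter.2 ⟨h, (mem_inter.1 hv).2⟩)).1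
        obtain ⟨hwSH, hwe⟩ := mem_sdiff.1 hw
        rw [mem_insert, mem_singleton, not_or] at hwe
        rw [← sum_shellIn_half_half_eq hπ hπ' (mem_inter.1 hv).1 (mem_inter.1 hwSH).1 hwe.1 hwe.2 t c g, sum_filter]
        refine sum_congr rfl fun U _ => ?_
        by_cases h1 : v ∈ U ∧ π v ∉ U
        · by_cases h2 : w ∈ U ∧ π w ∉ U
          · rw [if_pos h1, if_pos h2, if_pos ⟨h1, h2⟩]; ring
          · rw [if_neg h2, if_neg (show ¬((v ∈ U ∧ π v ∉ U) ∧ (w ∈ U ∧ π w ∉ U)) from fun h => h2 h.2)]; ring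
        · rw [if_neg h1, if_neg (show ¬((v ∈ U ∧ π v ∉ U) ∧ (w ∈ U ∧ π w ∉ U)) from fun h => h1 h.1)]; ring

/-- **The block statistic weighted by `Y(Y−1)`** is a double sum of shifted block-statistic sums on the doubly deleted
ground sets, at cut size and level two lower:
`Σ_{U ∈ Shell_S(t+2,c+2)} Y(Y−1)·ψ(|U∩H|) = Σ_{v ∈ S∩H} Σ_{w ∈ (S∩H)∖e_v} Σ_{W ∈ Shell_{S∖e_v∖e_w}(t,c)} ψ(|W∩H| + 2)`.
[cite: Rothvoss2017, §2 (PDF p. 6)] -/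
theorem sum_shellIn_halfPairs_blockStat_eq (S H : Finset (Fin n)) (t c : ℕ) (ψ : ℤ → ℝ) :
    ∑ U ∈ shellIn π S (t + 2) (c + 2),
        ((half π U ∩ H).card : ℝ) * (((half π U ∩ H).card : ℝ) - 1) * ψ ((U ∩ H).card : ℤ) =
      ∑ v ∈ S ∩ H, ∑ w ∈ (S ∩ H) \ {v, π v}, ∑ W ∈ shellIn π (del2 π S v w) t c, ψ (((W ∩ H).card : ℤ) + 2) := by
  rw [sum_shellIn_halfPairs_mul_eq hπ hπ' S H t c]
  refine sum_congr rfl fun v hv => sum_congr rfl fun w hw => sum_congr rfl fun W hW => ?_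
  obtain ⟨hwSH, hwe⟩ := mem_sdiff.1 hw
  rw [mem_insert, mem_singleton, not_or] at hwe
  have hWsub := (mem_shellIn.1 hW).1
  have hwW : w ∉ W := fun h => by have := (mem_del2.1 (hWsub h)); exact this.2.2.2.1 rfl
  have hvW : v ∉ insert w W := by
    rw [mem_insert, not_or]
    refine ⟨fun e => hwe.1 e.symm, fun h => ?_⟩
    have := (mem_del2.1 (hWsub h)); exact this.2.1 rfl
  rw [card_insert_inter_cast H hvW, card_insert_inter_cast H hwW, if_pos (mem_inter.1 hv).2, if_pos (mem_inter.1 hwSH).2]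
  ring_nf

/-- **Average form**: for `Shell_S(t+2,c+2) ≠ ∅`,
`E_{Shell_S(t+2,c+2)}[Y(Y−1)·ψ(|U∩H|)] = ((c+2)(c+1)/(|S|(|S|−2)))·Σ_{v ∈ S∩H} Σ_{w ∈ (S∩H)∖e_v} E_{Shell_{S∖e_v∖e_w}(t,c)}[ψ(|W∩H|+2)]`:
the pair-count weight becomes the level factor `(c+2)(c+1)/(|S|(|S|−2))`, vanishing at the two virtual levels below.
[cite: Rothvoss2017, §2 (PDF p. 6)] [cite: GodsilMeagher2015, §15.2] -/
theorem shellInAvg_halfPairs_blockStat_eq {S : Finset (Fin n)} (hS : ∀ u ∈ S, π u ∈ S) (H : Finset (Fin n))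
    (t c : ℕ) (ψ : ℤ → ℝ) (hne : (shellIn π S (t + 2) (c + 2)).Nonempty) :
    (∑ U ∈ shellIn π S (t + 2) (c + 2),
        ((half π U ∩ H).card : ℝ) * (((half π U ∩ H).card : ℝ) - 1) * ψ ((U ∩ H).card : ℤ)) /
        ((shellIn π S (t + 2) (c + 2)).card : ℝ) =
      ((((c : ℝ) + 2) * ((c : ℝ) + 1)) / ((S.card : ℝ) * ((S.card : ℝ) - 2))) *
        ∑ v ∈ S ∩ H, ∑ w ∈ (S ∩ H) \ {v, π v},
          (∑ W ∈ shellIn π (del2 π S v w) t c, ψ (((W ∩ H).card : ℤ) + 2)) /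
            ((shellIn π (del2 π S v w) t c).card : ℝ) := by
  rw [sum_shellIn_halfPairs_blockStat_eq hπ hπ' S H t c ψ, sum_div, mul_sum]
  refine sum_congr rfl fun v hv => ?_
  rw [sum_div, mul_sum]
  refine sum_congr rfl fun w hw => ?_
  have hvS : v ∈ S := (mem_inter.1 hv).1
  obtain ⟨hwSH, hwe⟩ := mem_sdiff.1 hw
  rw [mem_insert, mem_singleton, not_or] at hwe
  have hwS : w ∈ S := (mem_inter.1 hwSH).1
  have hr := card_shellIn_del2_half_ratio hπ hπ' hS hvS hwS hwe.1 hwe.2 t c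
  have hS4 : t + 2 + (c + 2) ≤ S.card := by obtain ⟨U, hU⟩ := hne; exact add_le_of_mem_shellIn hπ hS hU
  have h4 : (4 : ℝ) ≤ S.card := by
    have : 4 ≤ S.card := by omega
    exact_mod_cast this
  have hden : 0 < (S.card : ℝ) * ((S.card : ℝ) - 2) := mul_pos (by linarith) (by linarith)
  have hA : (0 : ℝ) < (shellIn π S (t + 2) (c + 2)).card := by exact_mod_cast hne.card_pos
  have hB : (0 : ℝ) < (shellIn π (del2 π S v w) t c).card := by
    exact_mod_cast (shellIn_del2_nonempty_of_half hπ hπ' hS hvS hwS hwe.1 hwe.2 hne).card_pos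
  rw [div_mul_div_comm, div_eq_div_iff hA.ne' (mul_ne_zero hden.ne' hB.ne')]
  linear_combination (∑ W ∈ shellIn π (del2 π S v w) t c, ψ (((W ∩ H).card : ℤ) + 2)) * hr

/-! ### §3 The crossing-plane containment form is a block statistic minus the half count -/

omit hπ hπ' in
/-- **Bridge to the (CG_1′) containment form**: for the crossing-plane vertex weight
`u_p = λ·([p∈H][πp∈H] − [p∉H][πp∉H]) + μ`, `Σ_p u_p·x_p·x_{πp} = λ·(|AA(full U)| − |DD(full U)|) + μ·|full U|` (`x = 𝟙_U`).
[cite: Rothvoss2017, §2 (PDF pp. 5–6)] -/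
theorem sum_crossingWeight_containment_eq (H U : Finset (Fin n)) (lam mu : ℝ) :
    ∑ p : Fin n, (lam * ((if (p ∈ H ∧ π p ∈ H) then (1 : ℝ) else 0) - (if (p ∉ H ∧ π p ∉ H) then (1 : ℝ) else 0)) + mu) *
        ((if p ∈ U then (1 : ℝ) else 0) * (if π p ∈ U then (1 : ℝ) else 0)) =
      lam * (((vAA π (full π U) H).card : ℝ) - ((vDD π (full π U) H).card : ℝ)) + mu * ((full π U).card : ℝ) := by
  -- `x_p x_{πp} = [p ∈ full U]`
  have hx : ∀ p : Fin n, ((if p ∈ U then (1 : ℝ) else 0) * (if π p ∈ U then (1 : ℝ) else 0)) =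
      if p ∈ full π U then (1 : ℝ) else 0 := by
    intro p
    by_cases h1 : p ∈ U
    · by_cases h2 : π p ∈ U
      · rw [if_pos h1, if_pos h2, if_pos (mem_full.2 ⟨h1, h2⟩)]; ring
      · rw [if_neg h2, if_neg (fun h => h2 (mem_full.1 h).2)]; ring
    · rw [if_neg h1, if_neg (fun h => h1 (mem_full.1 h).1)]; ring
  simp only [hx]
  have hAA : ((vAA π (full π U) H).card : ℝ) =
      ∑ p : Fin n, (if (p ∈ H ∧ π p ∈ H) then (1 : ℝ) else 0) * (if p ∈ full π U then (1 : ℝ) else 0) := by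
    rw [vAA, card_filter]; push_cast
    rw [← sum_subset (subset_univ (full π U))]
    · exact sum_congr rfl fun p hp => by rw [if_pos hp]; split_ifs <;> simp
    · intro p _ hp; rw [if_neg hp, mul_zero]
  have hDD : ((vDD π (full π U) H).card : ℝ) =
      ∑ p : Fin n, (if (p ∉ H ∧ π p ∉ H) then (1 : ℝ) else 0) * (if p ∈ full π U then (1 : ℝ) else 0) := by
    rw [vDD, card_filter]; push_cast
    rw [← sum_subset (subset_univ (full π U))]
    · exact sum_congr rfl fun p hp => by rw [if_pos hp]; split_ifs <;> simp
    · intro p _ hp; rw [if_neg hp, mul_zero]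
  have hF : ((full π U).card : ℝ) = ∑ p : Fin n, (if p ∈ full π U then (1 : ℝ) else 0) := by
    rw [card_eq_sum_ones]; push_cast
    rw [← sum_subset (subset_univ (full π U))]
    · exact sum_congr rfl fun p hp => by rw [if_pos hp]
    · intro p _ hp; rw [if_neg hp]
  rw [hAA, hDD, hF, ← sum_sub_distrib, mul_sum, mul_sum, ← sum_add_distrib]
  exact sum_congr rfl fun p _ => by ring

omit hπ' in
/-- **The crossing-plane containment form on a shell**: for `U ∈ Shell_S(t,c)`,
`Σ_p u_p x_p x_{πp} = 2λ·(|U ∩ H| − |half U ∩ H|) + (μ − λ)·(t − c)` — a BLOCK STATISTIC, minus `2λ` times the HALF COUNT, plus a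
level-linear constant (by `crossing_containment_eq` and `|full U| = t − c`). [cite: Rothvoss2017, §2 (PDF pp. 5–6)] -/
theorem crossingWeight_containment_eq (H : Finset (Fin n)) {S : Finset (Fin n)} {t c : ℕ} {U : Finset (Fin n)}
    (hU : U ∈ shellIn π S t c) (lam mu : ℝ) :
    ∑ p : Fin n, (lam * ((if (p ∈ H ∧ π p ∈ H) then (1 : ℝ) else 0) - (if (p ∉ H ∧ π p ∉ H) then (1 : ℝ) else 0)) + mu) *
        ((if p ∈ U then (1 : ℝ) else 0) * (if π p ∈ U then (1 : ℝ) else 0)) =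
      2 * lam * (((U ∩ H).card : ℝ) - ((half π U ∩ H).card : ℝ)) + (mu - lam) * ((t : ℝ) - c) := by
  rw [sum_crossingWeight_containment_eq H U lam mu]
  have h1 := crossing_containment_eq hπ H hU
  have h2 := card_full_of_mem_shellIn hU
  have h3 := le_of_mem_shellIn hU
  have h1' : ((vAA π (full π U) H).card : ℝ) - ((vDD π (full π U) H).card : ℝ) =
      2 * (((U ∩ H).card : ℝ) - ((half π U ∩ H).card : ℝ)) - ((t : ℝ) - c) := by exact_mod_cast h1
  have h2' : ((full π U).card : ℝ) = (t : ℝ) - c := by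
    rw [h2, Nat.cast_sub h3]
  rw [h1', h2']
  ring

end HalfPinTwo

end ShellStep

end Literature.Combinatorics.Optimization

end
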